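import Mathlib.LinearAlgebra.BilinearForm.Orthogonal
import Mathlib.LinearAlgebra.FiniteDimensional.Lemmas
import Mathlib.LinearAlgebra.Matrix.DotProduct
import Mathlib.Tactic.LinearCombination
import HarnessLib

/-!
# Alper–Bogart–Velasco, Thm. 1.2: isotropic subspaces of the split quadric

Topic `Literature/Computability/AlgebraicComplexity`; second file of the proof of the named fact
`alperBogartVelasco2017_cor_1_4` (`AlperBogartVelasco.lean`), following J. Alper, T. Bogart,
M. Velasco, *A lower bound for the determinantal complexity of a hypersurface*, Found. Comput.
Math. 17 (2017) 829–836, proof of Thm. 1.2 (arXiv:1505.02205 p. 5): "`im(G)` is a linear subspace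
which is entirely contained in the non-degenerate quadric `Σ_{j=2}^m w_{1j} w_{j1} = 0` in
`k^{2(m-1)}` … Such subspaces have dimension at most `m - 1` (c.f. [harris])".

We phrase the quadric through its (characteristic-free) polar form on `(ι → K) × (ι → K)`,
`β((p,q),(p',q')) = p ⬝ q' + p' ⬝ q`:

* `finrank_le_card_of_isotropic`: a subspace on which `β` vanishes identically has dimension
  `≤ |ι|` (it lies in its own `β`-orthogonal, of complementary dimension since `β` is
  non-degenerate: `LinearMap.BilinForm.finrank_orthogonal`);
* `finrank_add_one_le_card_of_isotropic`: if moreover the coordinates `p_{i₀}`, `q_{i₀}` vanish on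
  it, its dimension is `≤ |ι| - 1` (adjoin the isotropic vector `(e_{i₀}, 0)`), which is the
  form used by ABV (the subspace of `k^{2m}` cut out by `w_{11} = 0` on both sides is their
  `k^{2(m-1)}`).

## References

* J. Alper, T. Bogart, M. Velasco, Found. Comput. Math. 17 (2017) 829–836,
  doi:10.1007/s10208-015-9300-x, arXiv:1505.02205 — proof of Thm. 1.2.
* J. Harris, *Algebraic Geometry, a first course*, GTM 133, Springer 1992, Lecture 22 (linear
  spaces on quadrics). (Cited by ABV; not needed here beyond the elementary bound.)
-/

noncomputable section

open Module

namespace Literature.Computability.AlgebraicComplexity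

namespace AlperBogartVelasco

variable {K : Type*} [Field K] {ι : Type*} [Fintype ι] [DecidableEq ι]

/-- **Isotropic subspaces of the split quadric have dimension at most `|ι|`** (the bound quoted by
ABV from Harris, Lecture 22, in polar form): if `p ⬝ q' + p' ⬝ q = 0` for all `(p,q), (p',q')` in
a subspace `T` of `K^ι × K^ι`, then `dim T ≤ |ι|`, because `T ⊆ T^⊥` and
`dim T^⊥ = 2|ι| - dim T`. [cite: AlperBogartVelasco2017, proof of Thm. 1.2] -/
theorem finrank_le_card_of_isotropic (T : Submodule K ((ι → K) × (ι → K)))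
    (hT : ∀ z ∈ T, ∀ z' ∈ T, z.1 ⬝ᵥ z'.2 + z'.1 ⬝ᵥ z.2 = 0) :
    finrank K T ≤ Fintype.card ι := by
  -- the polar form of the split quadric, as a bilinear form
  let B : LinearMap.BilinForm K ((ι → K) × (ι → K)) :=
    LinearMap.mk₂ K (fun z z' => z.1 ⬝ᵥ z'.2 + z'.1 ⬝ᵥ z.2)
      (fun z₁ z₂ z' => by
        simp only [Prod.fst_add, Prod.snd_add, add_dotProduct, dotProduct_add]; ring)
      (fun c z z' => by
        simp only [Prod.smul_fst, Prod.smul_snd, smul_dotProduct, dotProduct_smul, smul_eq_mul]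
        ring)
      (fun z z₁ z₂ => by
        simp only [Prod.fst_add, Prod.snd_add, add_dotProduct, dotProduct_add]; ring)
      (fun c z z' => by
        simp only [Prod.smul_fst, Prod.smul_snd, smul_dotProduct, dotProduct_smul, smul_eq_mul]
        ring)
  have hB : ∀ z z', B z z' = z.1 ⬝ᵥ z'.2 + z'.1 ⬝ᵥ z.2 := fun _ _ => rfl
  -- it is non-degenerate: pair with `(0, e_i)` and `(e_i, 0)`
  have key : ∀ z : (ι → K) × (ι → K), (∀ z', B z z' = 0) → z = 0 := by
    intro z hz
    refine Prod.ext (funext fun i => ?_) (funext fun i => ?_)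
    · have h := hz (0, Pi.single i 1)
      simpa [hB] using h
    · have h := hz (Pi.single i 1, 0)
      simpa [hB] using h
  have hnd : B.Nondegenerate := by
    refine ⟨fun z hz => key z hz, fun z hz => key z fun z' => ?_⟩
    rw [← hz z', hB, hB, add_comm]
  have hle : T ≤ B.orthogonal T := by
    intro z hz
    rw [LinearMap.BilinForm.mem_orthogonal_iff]
    intro z' hz'
    exact hT z' hz' z hz
  have h1 := Submodule.finrank_mono hle
  rw [LinearMap.BilinForm.finrank_orthogonal hnd T, finrank_prod,
    finrank_fintype_fun_eq_card] at h1
  have h2 : finrank K T ≤ finrank K ((ι → K) × (ι → K)) := Submodule.finrank_le T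
  rw [finrank_prod, finrank_fintype_fun_eq_card] at h2
  omega

/-- **The form used by ABV**: if moreover `p_{i₀} = q_{i₀} = 0` on `T`, then `dim T ≤ |ι| - 1`
(ABV: "`im(G)` … contained in the non-degenerate quadric … in `k^{2(m-1)}` … dimension at most
`m - 1`"): `T ⊕ K·(e_{i₀}, 0)` is again isotropic. [cite: AlperBogartVelasco2017, proof of Thm. 1.2] -/
theorem finrank_add_one_le_card_of_isotropic (T : Submodule K ((ι → K) × (ι → K))) (i₀ : ι)
    (hT : ∀ z ∈ T, ∀ z' ∈ T, z.1 ⬝ᵥ z'.2 + z'.1 ⬝ᵥ z.2 = 0)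
    (h0 : ∀ z ∈ T, z.1 i₀ = 0 ∧ z.2 i₀ = 0) :
    finrank K T + 1 ≤ Fintype.card ι := by
  let e : (ι → K) × (ι → K) := (Pi.single i₀ 1, 0)
  have he : e ∉ T := fun h => by simpa [e] using (h0 e h).1
  -- pairing with `e` only sees the coordinate `q_{i₀}`
  have hTe : ∀ z ∈ T, z.1 ⬝ᵥ e.2 + e.1 ⬝ᵥ z.2 = 0 := fun z hz => by
    simp [e, (h0 z hz).2]
  have hee : e.1 ⬝ᵥ e.2 + e.1 ⬝ᵥ e.2 = 0 := by simp [e]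
  have hiso : ∀ z ∈ T ⊔ K ∙ e, ∀ z' ∈ T ⊔ K ∙ e, z.1 ⬝ᵥ z'.2 + z'.1 ⬝ᵥ z.2 = 0 := by
    intro z hz z' hz'
    obtain ⟨t, ht, w, hw, rfl⟩ := Submodule.mem_sup.1 hz
    obtain ⟨t', ht', w', hw', rfl⟩ := Submodule.mem_sup.1 hz'
    obtain ⟨c, rfl⟩ := Submodule.mem_span_singleton.1 hw
    obtain ⟨c', rfl⟩ := Submodule.mem_span_singleton.1 hw'
    have h1 := hT t ht t' ht'
    have h2 := hTe t ht
    have h3 := hTe t' ht'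
    simp only [Prod.fst_add, Prod.snd_add, Prod.smul_fst, Prod.smul_snd, add_dotProduct,
      dotProduct_add, smul_dotProduct, dotProduct_smul, smul_eq_mul] at h1 h2 h3 hee ⊢
    linear_combination h1 + c' * h2 + c * h3 + c * c' * hee
  have hbound := finrank_le_card_of_isotropic (T ⊔ K ∙ e) hiso
  have hne : e ≠ 0 := fun h => by
    have := congr_fun (congr_arg Prod.fst h) i₀
    simp [e] at this
  have hdisj : T ⊓ (K ∙ e) = ⊥ := disjoint_iff.1 ((Submodule.disjoint_span_singleton' hne).2 he)
  have hsum := Submodule.finrank_sup_add_finrank_inf_eq T (K ∙ e)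
  rw [hdisj, finrank_bot, add_zero, finrank_span_singleton hne] at hsum
  omega

end AlperBogartVelasco

end Literature.Computability.AlgebraicComplexity
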